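import Summits.QuantumFields.YangMills.Theorems.UnitScaleTiltProp7RowPOfCombFaceFluxRows
import Summits.QuantumFields.YangMills.Theorems.UnitScaleTiltProp7LinAvgDefectOfExactFibrePoint
import HarnessLib

/-!
# Route `UnitScaleTilt`, crux K1 «MinimiserStabilityRegPr» (stmt-QuantumFields-19200), route-R E′ S3 — ROW (P′) WITH THE K-SLOT FOR `hq`, AND `hq` DISCHARGED AT THE E′ MEMBER

Cell `ym3-torus`, D-0154 (3c) twin-width seat `ym-routeR-w2` (gen 7), 2026-08-29.  ★p1 g16 NAMER WORD 10 (2026-08-28 23:55Z) and ★p1 g17 WORD 1 (01:09Z, «KNIT v1.1 — GO, WITH THE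
K-SLOT») book the fibre-defect row of (P′) in the THREE-slot shape `8·Σ_c‖Q^{(K−n)}D c‖² ≤ θ_q·ℓ⁻¹·M + ζ_q·ℓ·K(D) + η_q·ℓ·DIV(D)`; the landed knit v1.1 ✓ `Prop7RowPOfCombFaceFluxRows.rowP_of_combFaceFluxRows`
displays `hq` with TWO slots (`θ_q`, `η_q`), while the landed inhabitant ✓ `Prop7LinAvgDefectOfExactFibrePoint.linAvgDefect_of_exactFibrePoint` has three (`A_M·sQ²·ℓ⁻¹·M + A_K·sQ²·ℓ·(K + DIV)`,
`A_M = 1.5·10¹⁹L¹⁸`, `A_K = 2.4·10²²L²⁰`).  This file closes the bookkeeping gap WITHOUT re-knitting: `θ_q` is a free real in the knit, so the `ζ_q·ℓ·K` slot is absorbed into it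
(`θ_q′ := θ_q + ζ_q·ℓ²·K∕M` when `M = Σ‖D‖² > 0`; when `M = 0` the field `D` vanishes and so does `K(D)`), and then the member row is plugged in by `exact`.
THEOREMS ONLY (0 `def`, 0 `sorry`); `--supports stmt-QuantumFields-19200 --as helper`, count-neutral.  YM₃ on T³ is a ladder rung (R3), not the Clay problem; nothing here claims
the stub, the crux, E′, d = 4 or the mass gap; ROW (P′) keeps ONE displayed row (`hXb′`, px15's «HXB′ DOOR»).

WHAT IS PROVED (ns `…Theorems.Prop7RowPOfCombFaceFluxRowsHq3`; T³, `SU(2)`).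
* ★★ `rowP_of_combFaceFluxRows_hq3` — the binders of ✓ `rowP_of_combFaceFluxRows` VERBATIM except that `hq` carries the K-slot `+ ζ_q·ℓ·K(D)`; conclusion = ROW (P′) at
  `(ζ_X∕θ + ζ_q, θ + θ_q, θ_X + 64(C_G+C_S²) + 768·10⁹L⁹ + 16, C_X + 24, 19200L⁴, η_X + η_q)`.
* ★★★ `rowP_of_combFaceFluxRows_member` — AT THE E′ MEMBER (`W, Y ∈ regFibrePr F n K _ e V`, sup chart `‖Y(b)W(b)⁻¹ − 1‖ ≤ sQ·ℓ⁻¹`, `D = −i·log(YW⁻¹)` bondwise, `Q` the true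
  linearised iterate at `W`): ROW (P′) from the single displayed row `hXb′`, the defect row DISCHARGED by ✓ `linAvgDefect_of_exactFibrePoint` (×8):
  constants `(ζ_X∕θ + 8A_K·sQ², θ + 8A_M·sQ², θ_X + 64(C_G+C_S²) + 768·10⁹L⁹ + 16, C_X + 24, 19200L⁴, η_X + 8A_K·sQ²)`.
HONEST SCOPE.  Bookkeeping over two landed theorems; no estimate of Bałaban's is asserted beyond them; `hXb′` stays an INPUT.

References: T. Bałaban, CMP 102 (1985) 277–309 [Balaban1985Variational] ((6) p.278, (141)–(143) p.299, Prop. 7 p.299); CMP 98 (1985) 17–51 [Balaban1985Averaging] (Prop. 3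
(122)–(126) p.36, Prop. 4 (134)–(135) p.38); CMP 99 (1985) 389–434 [Balaban1985BackgroundPropagators] ((3.3) p.390, Thm 3.11 p.416).
-/

set_option autoImplicit false

noncomputable section

open scoped BigOperators Matrix.Norms.L2Operator Matrix

namespace Summit.QuantumFields.YangMills.Theorems.Prop7RowPOfCombFaceFluxRowsHq3
open Literature.MathematicalPhysics.QuantumFieldTheory.Balaban1983to89
open Literature.MathematicalPhysics.QuantumFieldTheory.Balaban1983to89.T3ContinuumYM3Torus
open Literature.MathematicalPhysics.QuantumFieldTheory.Balaban1983to89.T3PrintedRegularMinimiser (regFibrePr)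
open Finset T4Continuum T4ReflectionCone BlockAveraging AveragingRT ExpMeanLog BlockAveragingEMLLinearised BlockAveragingEMLLinearisedBackground
  BlockAveragingEMLProp2 B1RG242Torus
open B15DeterminingSets (embIter)
open B7Prop1Explicit (treeWord)
open B7Eq78Linearization (conjR)
open B9Eq39Adjoint (covD divB curl)
open B9TorusCalculus (torusT)
open B10Eq27TorusAxialLog (holT unitsField toUField)
open MatrixLog (mlog)
open Summit.QuantumFields.YangMills.Theorems.Prop7CurvedLandauKnitT3 (three_le_L)
open Summit.QuantumFields.YangMills.Theorems.Prop7CoclosedEnergiesOfHKgK (dist1_plaqHol_le_of_mem_regFibrePr)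
open Summit.QuantumFields.YangMills.Theorems.Prop7RowPOfCombFaceFluxRows (rowP_of_combFaceFluxRows)
open Summit.QuantumFields.YangMills.Theorems.Prop7LinAvgDefectOfExactFibrePoint (linAvgDefect_of_exactFibrePoint)

/-! ## §0 The absorption of a slot into a free coefficient (pure reals) -/

/-- Pure-real bookkeeping: a three-slot bound `S ≤ θ_q·ℓ⁻¹·M + ζ_q·ℓ·K + R` with `0 ≤ M` and `M = 0 → K = 0` is a two-slot bound `S ≤ θ_q′·ℓ⁻¹·M + R` for some real `θ_q′`
with `θ_q′·ℓ⁻¹·M = θ_q·ℓ⁻¹·M + ζ_q·ℓ·K` (`θ_q′ = θ_q + ζ_q·ℓ²·K∕M` when `M > 0`, `θ_q′ = θ_q` when `M = 0`). -/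
theorem absorb_K_slot {S ℓ M Kc R θ_q ζ_q : ℝ} (hℓ : 0 < ℓ) (hM : 0 ≤ M) (hK : M = 0 → Kc = 0)
    (h : S ≤ θ_q * ℓ⁻¹ * M + ζ_q * ℓ * Kc + R) :
    ∃ θ_q' : ℝ, S ≤ θ_q' * ℓ⁻¹ * M + R ∧ θ_q' * ℓ⁻¹ * M = θ_q * ℓ⁻¹ * M + ζ_q * ℓ * Kc := by
  rcases eq_or_lt_of_le hM with hM0 | hMpos
  · have hK0 : Kc = 0 := hK hM0.symm
    refine ⟨θ_q, ?_, ?_⟩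
    · rw [hK0, mul_zero, add_zero] at h
      exact h
    · rw [hK0, mul_zero, add_zero]
  · have hne : M ≠ 0 := hMpos.ne'
    have hℓne : ℓ ≠ 0 := hℓ.ne'
    have heq : (θ_q + ζ_q * ℓ ^ 2 * Kc / M) * ℓ⁻¹ * M = θ_q * ℓ⁻¹ * M + ζ_q * ℓ * Kc := by
      field_simp
    exact ⟨θ_q + ζ_q * ℓ ^ 2 * Kc / M, by linarith only [heq, h], heq⟩

/-! ## §1 ★★ ROW (P′) with the K-slot for the defect row -/

set_option maxHeartbeats 400000 in
/-- ★★ **ROW (P′), THREE-SLOT DEFECT ROW.**  Exactly ✓ `Prop7RowPOfCombFaceFluxRows.rowP_of_combFaceFluxRows` (knit v1.1, comb-direct face functional `FACE′`), but the displayed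
fibre-defect row `hq` carries the K-slot of the namer's ruling: `8·Σ_c‖Q^{(K−n)}D c‖² ≤ θ_q·ℓ⁻¹·M + ζ_q·ℓ·K(D) + η_q·ℓ·DIV(D)` (`M = Σ‖D‖²`, `K(D) = Σ_p‖ℒ_p(D)‖²` the display's
K-letter, `DIV(D)` the R5 door's letter).  CONCLUSION = ROW (P′) at `(ζ_X∕θ + ζ_q, θ + θ_q, θ_X + 64(C_G+C_S²) + 768·10⁹L⁹ + 16, C_X + 24, 19200L⁴, η_X + η_q)`.
PROOF: `θ_q` is free in the knit — absorb `ζ_q·ℓ·K` into it (`θ_q′ = θ_q + ζ_q·ℓ²·K∕M` if `M > 0`; if `M = 0` then `D = 0` and `K(D) = 0`).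
[cite: Balaban1985Variational, (6) p.278, (141)-(143) p.299, Prop. 7 p.299; Balaban1985Averaging, Prop. 3 (124)-(126) p.36; Balaban1985BackgroundPropagators, (3.3) p.390, Thm 3.11 p.416] -/
theorem rowP_of_combFaceFluxRows_hq3 (F : T3Family) (n K : ℕ) (W : GaugeField (F.P K) 0 (Matrix.specialUnitaryGroup (Fin 2) ℂ))
    {e θ ζ_X θ_X C_X η_X θ_q ζ_q η_q : ℝ} (he : 0 < e) (heL : 1000000 * (F.L : ℝ) ^ 5 * e ≤ 1)
    (hW : ∀ p : Plaq (F.P K) 0, dist1 (GaugeField.plaqHol W p) ≤ e * (((F.L : ℝ) ^ (K - n)) ^ 2)⁻¹)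
    (D B : PBond (F.P K) 0 → Matrix (Fin 2) (Fin 2) ℂ) (φ₀ : Site (F.P K) 0 → Matrix (Fin 2) (Fin 2) ℂ)
    (hsplit : ∀ b : PBond (F.P K) 0, D b = B b + covD (torusT (F.P K) 0) (fun κ z => unitsField (toUField W) ⟨z, κ⟩) b.dir φ₀ b.src)
    (hBc : ∀ x : Site (F.P K) 0, divB (torusT (F.P K) 0) (fun κ z => unitsField (toUField W) ⟨z, κ⟩) (fun κ z => B ⟨z, κ⟩) x = 0)
    -- the true linearised iterate of record, displayed by its recursion (✓`exists_trueLinIter_family`)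
    (Q : (k : ℕ) → (PBond (F.P K) 0 → Matrix (Fin 2) (Fin 2) ℂ) → PBond (F.P K) k → Matrix (Fin 2) (Fin 2) ℂ) (hQ0 : ∀ Y, Q 0 Y = Y)
    (hQs : ∀ (k : ℕ) (Y : PBond (F.P K) 0 → Matrix (Fin 2) (Fin 2) ℂ) (c : PBond (F.P K) (k + 1)), Q (k + 1) Y c
      = fderiv ℂ (eml : (Idx (F.P K) → Matrix (Fin 2) (Fin 2) ℂ) → Matrix (Fin 2) (Fin 2) ℂ)
            (fun i => ((loopHol (Averaging.iter (fun i => blockAvg (P := F.P K) (j := i) (expMeanLogSU (n := Fin 2))) k W) c i :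
              Matrix.specialUnitaryGroup (Fin 2) ℂ) : Matrix (Fin 2) (Fin 2) ℂ))
            (fun i => covWalkSum (Averaging.iter (fun i => blockAvg (P := F.P K) (j := i) (expMeanLogSU (n := Fin 2))) k W) (Q k Y)
                (walk (emb c.src) (loopWord (F.P K).L c.dir (off i.1) i.2.1 i.2.2))
              * ((loopHol (Averaging.iter (fun i => blockAvg (P := F.P K) (j := i) (expMeanLogSU (n := Fin 2))) k W) c i :
                Matrix.specialUnitaryGroup (Fin 2) ℂ) : Matrix (Fin 2) (Fin 2) ℂ))
            * star ((corr (expMeanLogSU (n := Fin 2)) (Averaging.iter (fun i => blockAvg (P := F.P K) (j := i) (expMeanLogSU (n := Fin 2))) k W) c :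
                Matrix.specialUnitaryGroup (Fin 2) ℂ) : Matrix (Fin 2) (Fin 2) ℂ)
          + ((corr (expMeanLogSU (n := Fin 2)) (Averaging.iter (fun i => blockAvg (P := F.P K) (j := i) (expMeanLogSU (n := Fin 2))) k W) c :
                Matrix.specialUnitaryGroup (Fin 2) ℂ) : Matrix (Fin 2) (Fin 2) ℂ)
            * covWalkSum (Averaging.iter (fun i => blockAvg (P := F.P K) (j := i) (expMeanLogSU (n := Fin 2))) k W) (Q k Y)
                (walk (emb c.src) (List.replicate (F.P K).L (c.dir, true)))
            * star ((corr (expMeanLogSU (n := Fin 2)) (Averaging.iter (fun i => blockAvg (P := F.P K) (j := i) (expMeanLogSU (n := Fin 2))) k W) c :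
                Matrix.specialUnitaryGroup (Fin 2) ℂ) : Matrix (Fin 2) (Fin 2) ℂ))
    -- ▢ hq — THE FIBRE-DEFECT ROW, THREE-SLOT (★p1 g16 WORD 10; routeR-w2 ✓`linAvgDefect_of_exactFibrePoint`): `8·Σ_c‖Q^{(K−n)}D(c)‖² ≤ θ_q·ℓ⁻¹·M + ζ_q·ℓ·K(D) + η_q·ℓ·DIV(D)`
    (hq : 8 * ∑ c : PBond (F.P K) (K - n), ‖Q (K - n) D c‖ ^ 2 ≤ θ_q * ((F.L : ℝ) ^ (K - n))⁻¹ * (∑ b : PBond (F.P K) 0, ‖D b‖ ^ 2)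
        + ζ_q * ((F.L : ℝ) ^ (K - n)) * (∑ p : Plaq (F.P K) 0, ‖((Complex.I • D ⟨p.src, p.μ⟩) + ((W ⟨p.src, p.μ⟩ : Matrix (Fin 2) (Fin 2) ℂ) * (Complex.I • D ⟨p.src.shift p.μ, p.ν⟩) * star (W ⟨p.src, p.μ⟩ : Matrix (Fin 2) (Fin 2) ℂ))
            - (((W ⟨p.src, p.μ⟩ * W ⟨p.src.shift p.μ, p.ν⟩ * (W ⟨p.src.shift p.ν, p.μ⟩)⁻¹ : Matrix.specialUnitaryGroup (Fin 2) ℂ) : Matrix (Fin 2) (Fin 2) ℂ) * (Complex.I • D ⟨p.src.shift p.ν, p.μ⟩) * star ((W ⟨p.src, p.μ⟩ * W ⟨p.src.shift p.μ, p.ν⟩ * (W ⟨p.src.shift p.ν, p.μ⟩)⁻¹ : Matrix.specialUnitaryGroup (Fin 2) ℂ) : Matrix (Fin 2) (Fin 2) ℂ))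
            - (((GaugeField.plaqHol W p : Matrix.specialUnitaryGroup (Fin 2) ℂ) : Matrix (Fin 2) (Fin 2) ℂ) * (Complex.I • D ⟨p.src, p.ν⟩) * star ((GaugeField.plaqHol W p : Matrix.specialUnitaryGroup (Fin 2) ℂ) : Matrix (Fin 2) (Fin 2) ℂ)))‖ ^ 2)
        + η_q * ((F.L : ℝ) ^ (K - n)) * (∑ x : Site (F.P K) 0, ∑ j : Fin 2, ∑ k : Fin 2,
              ‖(divB (torusT (F.P K) 0) (fun κ z => unitsField (toUField W) ⟨z, κ⟩) (fun κ z => Complex.I • D ⟨z, κ⟩) x) j k‖ ^ 2))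
    -- ▢ hXb′ — THE GAUSS COMPOSITE against the COMB-DIRECT face functional FACE′ (corner comb `treeWord (update r μ_c (ℓ−1))`, far-face crossing `t₀ = ℓ − 1 − r_{μ_c}`, centre frame)
    (hXb' : 2 * |∑ c : PBond (F.P K) (K - n), (((φ₀ (embIter (K - n) c.src)
          - ((Averaging.iter (fun i => blockAvg (P := F.P K) (j := i) (expMeanLogSU (n := Fin 2))) (K - n) W c : Matrix.specialUnitaryGroup (Fin 2) ℂ) : Matrix (Fin 2) (Fin 2) ℂ)
              * φ₀ (embIter (K - n) c.tgt)
              * star ((Averaging.iter (fun i => blockAvg (P := F.P K) (j := i) (expMeanLogSU (n := Fin 2))) (K - n) W c : Matrix.specialUnitaryGroup (Fin 2) ℂ) : Matrix (Fin 2) (Fin 2) ℂ))ᴴ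
          * ((((((F.P K).L : ℝ) ^ (K - n)) ^ (F.P K).d)⁻¹ •
              (((holAt W (walk (embIter (K - n) c.src) (treeWord fun _ : Fin (F.P K).d => -((((F.P K).L ^ (K - n) - 1) / 2 : ℕ) : ℤ))) : Matrix.specialUnitaryGroup (Fin 2) ℂ) :
                  Matrix (Fin 2) (Fin 2) ℂ)
                * ((((F.P K).L : ℝ) ^ (K - n)) • ∑ r : Fin (F.P K).d → Fin ((F.P K).L ^ (K - n)),
                    conjR (holT (unitsField (toUField W)) (Site.fibreSite 0 (K - n) c.src fun _ => ⟨0, pow_pos (F.P K).L_pos (K - n)⟩)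
                        (treeWord fun ν => ((Function.update r c.dir ⟨(F.P K).L ^ (K - n) - 1, Nat.sub_lt (pow_pos (F.P K).L_pos (K - n)) Nat.one_pos⟩ ν : ℕ) : ℤ)))
                      (B ⟨(fun z : Site (F.P K) 0 => z.shift c.dir)^[(F.P K).L ^ (K - n) - 1 - (r c.dir : ℕ)] (Site.fibreSite 0 (K - n) c.src r), c.dir⟩))
                * star (((holAt W (walk (embIter (K - n) c.src) (treeWord fun _ : Fin (F.P K).d => -((((F.P K).L ^ (K - n) - 1) / 2 : ℕ) : ℤ))) : Matrix.specialUnitaryGroup (Fin 2) ℂ) :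
                  Matrix (Fin 2) (Fin 2) ℂ)))))).trace).re|
      ≤ ((F.L : ℝ) ^ (K - n)) * (ζ_X / θ) * (∑ p : Plaq (F.P K) 0, ‖((Complex.I • D ⟨p.src, p.μ⟩) + ((W ⟨p.src, p.μ⟩ : Matrix (Fin 2) (Fin 2) ℂ) * (Complex.I • D ⟨p.src.shift p.μ, p.ν⟩) * star (W ⟨p.src, p.μ⟩ : Matrix (Fin 2) (Fin 2) ℂ))
            - (((W ⟨p.src, p.μ⟩ * W ⟨p.src.shift p.μ, p.ν⟩ * (W ⟨p.src.shift p.ν, p.μ⟩)⁻¹ : Matrix.specialUnitaryGroup (Fin 2) ℂ) : Matrix (Fin 2) (Fin 2) ℂ) * (Complex.I • D ⟨p.src.shift p.ν, p.μ⟩) * star ((W ⟨p.src, p.μ⟩ * W ⟨p.src.shift p.μ, p.ν⟩ * (W ⟨p.src.shift p.ν, p.μ⟩)⁻¹ : Matrix.specialUnitaryGroup (Fin 2) ℂ) : Matrix (Fin 2) (Fin 2) ℂ))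
            - (((GaugeField.plaqHol W p : Matrix.specialUnitaryGroup (Fin 2) ℂ) : Matrix (Fin 2) (Fin 2) ℂ) * (Complex.I • D ⟨p.src, p.ν⟩) * star ((GaugeField.plaqHol W p : Matrix.specialUnitaryGroup (Fin 2) ℂ) : Matrix (Fin 2) (Fin 2) ℂ)))‖ ^ 2)
        + θ * ((F.L : ℝ) ^ (K - n))⁻¹ * (∑ b : PBond (F.P K) 0, ‖D b‖ ^ 2)
        + θ_X * e * ((F.L : ℝ) ^ (K - n))⁻¹ * (∑ b : PBond (F.P K) 0, ‖D b‖ ^ 2)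
        + C_X * ((F.L : ℝ) ^ (K - n)) * (∑ b : PBond (F.P K) 0, ∑ ν : Fin (F.P K).d,
                ‖((W ⟨b.src, ν⟩ : Matrix.specialUnitaryGroup (Fin 2) ℂ) : Matrix (Fin 2) (Fin 2) ℂ) * B ⟨b.src.shift ν, b.dir⟩ * star ((W ⟨b.src, ν⟩ : Matrix.specialUnitaryGroup (Fin 2) ℂ) : Matrix (Fin 2) (Fin 2) ℂ) - B b‖ ^ 2)
        + η_X * ((F.L : ℝ) ^ (K - n)) * (∑ x : Site (F.P K) 0, ∑ j : Fin 2, ∑ k : Fin 2,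
              ‖(divB (torusT (F.P K) 0) (fun κ z => unitsField (toUField W) ⟨z, κ⟩) (fun κ z => Complex.I • D ⟨z, κ⟩) x) j k‖ ^ 2)) :
    (∑ c : PBond (F.P K) (K - n), ∑ a : Fin 2, ∑ b : Fin 2,
        Complex.normSq ((φ₀ (embIter (K - n) c.src) - ((Averaging.iter (fun i => blockAvg (P := F.P K) (j := i) (expMeanLogSU (n := Fin 2))) (K - n) W c : Matrix.specialUnitaryGroup (Fin 2) ℂ) : Matrix (Fin 2) (Fin 2) ℂ)
            * φ₀ (embIter (K - n) c.tgt) * star ((Averaging.iter (fun i => blockAvg (P := F.P K) (j := i) (expMeanLogSU (n := Fin 2))) (K - n) W c : Matrix.specialUnitaryGroup (Fin 2) ℂ) : Matrix (Fin 2) (Fin 2) ℂ)) a b))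
      ≤ ((F.L : ℝ) ^ (K - n)) * (ζ_X / θ + ζ_q) * (∑ p : Plaq (F.P K) 0, ‖((Complex.I • D ⟨p.src, p.μ⟩) + ((W ⟨p.src, p.μ⟩ : Matrix (Fin 2) (Fin 2) ℂ) * (Complex.I • D ⟨p.src.shift p.μ, p.ν⟩) * star (W ⟨p.src, p.μ⟩ : Matrix (Fin 2) (Fin 2) ℂ))
            - (((W ⟨p.src, p.μ⟩ * W ⟨p.src.shift p.μ, p.ν⟩ * (W ⟨p.src.shift p.ν, p.μ⟩)⁻¹ : Matrix.specialUnitaryGroup (Fin 2) ℂ) : Matrix (Fin 2) (Fin 2) ℂ) * (Complex.I • D ⟨p.src.shift p.ν, p.μ⟩) * star ((W ⟨p.src, p.μ⟩ * W ⟨p.src.shift p.μ, p.ν⟩ * (W ⟨p.src.shift p.ν, p.μ⟩)⁻¹ : Matrix.specialUnitaryGroup (Fin 2) ℂ) : Matrix (Fin 2) (Fin 2) ℂ))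
            - (((GaugeField.plaqHol W p : Matrix.specialUnitaryGroup (Fin 2) ℂ) : Matrix (Fin 2) (Fin 2) ℂ) * (Complex.I • D ⟨p.src, p.ν⟩) * star ((GaugeField.plaqHol W p : Matrix.specialUnitaryGroup (Fin 2) ℂ) : Matrix (Fin 2) (Fin 2) ℂ)))‖ ^ 2)
        + (θ + θ_q) * ((F.L : ℝ) ^ (K - n))⁻¹ * (∑ b : PBond (F.P K) 0, ‖D b‖ ^ 2)
        + (θ_X + 64 * ((4770 * (F.L : ℝ) ^ 3) ^ 2 * ((5 * (F.L : ℝ)) ^ 2 / 2) ^ 2 / 4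
              + (2 * (5 * (F.L : ℝ)) ^ 3 / ((F.L : ℝ) * ((F.L : ℝ) - 1) * ((F.L : ℝ) ^ 2 - 1)) + (2 * (5 * (F.L : ℝ)) + 2 * 3 + 1) ^ 2 / 2) ^ 2)
              + 768000000000 * (F.L : ℝ) ^ 9 + 16) * e * ((F.L : ℝ) ^ (K - n))⁻¹ * (∑ b : PBond (F.P K) 0, ‖D b‖ ^ 2)
        + (C_X + 24) * ((F.L : ℝ) ^ (K - n)) * (∑ b : PBond (F.P K) 0, ∑ ν : Fin (F.P K).d,
                ‖((W ⟨b.src, ν⟩ : Matrix.specialUnitaryGroup (Fin 2) ℂ) : Matrix (Fin 2) (Fin 2) ℂ) * B ⟨b.src.shift ν, b.dir⟩ * star ((W ⟨b.src, ν⟩ : Matrix.specialUnitaryGroup (Fin 2) ℂ) : Matrix (Fin 2) (Fin 2) ℂ) - B b‖ ^ 2)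
        + 19200 * (F.L : ℝ) ^ 4 * ((F.L : ℝ) ^ (K - n)) * (∑ x : Site (F.P K) 0, ∑ μ : Fin (F.P K).d, ∑ ν : Fin (F.P K).d,
                (if μ < ν then ∑ j : Fin 2, ∑ k : Fin 2, ‖(curl (torusT (F.P K) 0) (fun κ z => unitsField (toUField W) ⟨z, κ⟩) (fun κ z => B ⟨z, κ⟩) μ ν x) j k‖ ^ 2 else 0))
        + (η_X + η_q) * ((F.L : ℝ) ^ (K - n)) * (∑ x : Site (F.P K) 0, ∑ j : Fin 2, ∑ k : Fin 2,
              ‖(divB (torusT (F.P K) 0) (fun κ z => unitsField (toUField W) ⟨z, κ⟩) (fun κ z => Complex.I • D ⟨z, κ⟩) x) j k‖ ^ 2) := by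
  have hℓ : (0 : ℝ) < (F.L : ℝ) ^ (K - n) := pow_pos (by have := three_le_L F; positivity) _
  have hMD0 : 0 ≤ (∑ b : PBond (F.P K) 0, ‖D b‖ ^ 2) := Finset.sum_nonneg fun _ _ => sq_nonneg _
  -- if the chart's mass vanishes, the chart vanishes bondwise, hence so does its curvature letter
  have hKM : (∑ b : PBond (F.P K) 0, ‖D b‖ ^ 2) = 0 →
      (∑ p : Plaq (F.P K) 0, ‖((Complex.I • D ⟨p.src, p.μ⟩) + ((W ⟨p.src, p.μ⟩ : Matrix (Fin 2) (Fin 2) ℂ) * (Complex.I • D ⟨p.src.shift p.μ, p.ν⟩) * star (W ⟨p.src, p.μ⟩ : Matrix (Fin 2) (Fin 2) ℂ))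
              - (((W ⟨p.src, p.μ⟩ * W ⟨p.src.shift p.μ, p.ν⟩ * (W ⟨p.src.shift p.ν, p.μ⟩)⁻¹ : Matrix.specialUnitaryGroup (Fin 2) ℂ) : Matrix (Fin 2) (Fin 2) ℂ) * (Complex.I • D ⟨p.src.shift p.ν, p.μ⟩) * star ((W ⟨p.src, p.μ⟩ * W ⟨p.src.shift p.μ, p.ν⟩ * (W ⟨p.src.shift p.ν, p.μ⟩)⁻¹ : Matrix.specialUnitaryGroup (Fin 2) ℂ) : Matrix (Fin 2) (Fin 2) ℂ))
              - (((GaugeField.plaqHol W p : Matrix.specialUnitaryGroup (Fin 2) ℂ) : Matrix (Fin 2) (Fin 2) ℂ) * (Complex.I • D ⟨p.src, p.ν⟩) * star ((GaugeField.plaqHol W p : Matrix.specialUnitaryGroup (Fin 2) ℂ) : Matrix (Fin 2) (Fin 2) ℂ)))‖ ^ 2) = 0 := by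
    intro hM
    have hD0 : ∀ b : PBond (F.P K) 0, D b = 0 := by
      intro b
      have hb := (Finset.sum_eq_zero_iff_of_nonneg (fun b _ => sq_nonneg (‖D b‖))).1 hM b (Finset.mem_univ b)
      exact norm_eq_zero.1 (pow_eq_zero_iff two_ne_zero |>.1 hb)
    refine Finset.sum_eq_zero fun p _ => ?_
    simp only [hD0, smul_zero, mul_zero, zero_mul, sub_zero, add_zero, norm_zero, ne_eq, OfNat.ofNat_ne_zero,
      not_false_eq_true, zero_pow]
  -- absorb the K-slot into the knit's free real `θ_q`
  obtain ⟨θ_q', hq2, heq⟩ := absorb_K_slot hℓ hMD0 hKM hq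
  have hfin := rowP_of_combFaceFluxRows F n K W (θ := θ) (ζ_X := ζ_X) (θ_X := θ_X) (C_X := C_X) (η_X := η_X) (θ_q := θ_q') (η_q := η_q)
    he heL hW D B φ₀ hsplit hBc Q hQ0 hQs hq2 hXb'
  linarith only [hfin, heq]

/-! ## §2 ★★★ ROW (P′) at the E′ member — the defect row discharged -/

set_option maxHeartbeats 400000 in
/-- ★★★ **ROW (P′) AT THE E′ MEMBER, `hq` DISCHARGED.**  `F` a T³ family, `n < K`, `0 < e`, `10¹⁴L⁹e ≤ 1`; `W, Y ∈ (6)(e) ∩ 𝔅_k(V)` (`regFibrePr`); sup chart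
`‖Y(b)W(b)⁻¹ − 1‖ ≤ sQ·ℓ⁻¹` with `0 ≤ sQ`, `8·10¹¹L⁹sQ ≤ 1`; `D = −i·log(YW⁻¹)` bondwise; `Q` the true linearised iterate at background `W` (`hQ0`, `hQs`); the coclosed split
`D = B + D_Wφ₀` (`hsplit`, `hBc`); the ONE displayed row `hXb′` (Gauss composite against the comb-direct face functional — px15's «HXB′ DOOR»).  THEN ROW (P′) holds at
`(ζ_X∕θ + 8A_K·sQ², θ + 8A_M·sQ², θ_X + 64(C_G+C_S²) + 768·10⁹L⁹ + 16, C_X + 24, 19200L⁴, η_X + 8A_K·sQ²)`, `A_M = 1.5·10¹⁹L¹⁸`, `A_K = 2.4·10²²L²⁰`: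
✓ `rowP_of_combFaceFluxRows_hq3` with `hq` := 8 × ✓ `linAvgDefect_of_exactFibrePoint`, the background plaquette row from membership (✓ `dist1_plaqHol_le_of_mem_regFibrePr`).
[cite: Balaban1985Variational, (6) p.278, (141)-(143) p.299, Prop. 7 p.299; Balaban1985Averaging, Prop. 3 (122)-(126) p.36, Prop. 4 (134)-(135) p.38; Balaban1985BackgroundPropagators, (3.3) p.390, Thm 3.11 p.416] -/
theorem rowP_of_combFaceFluxRows_member (F : T3Family) {n K : ℕ} (hnK : n < K) {e : ℝ} (he : 0 < e)
    (heL : 100000000000000 * (F.L : ℝ) ^ 9 * e ≤ 1)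
    {V : GaugeField (F.P n) 0 (Matrix.specialUnitaryGroup (Fin 2) ℂ)} {W Y : GaugeField (F.P K) 0 (Matrix.specialUnitaryGroup (Fin 2) ℂ)}
    (hW : W ∈ regFibrePr F n K hnK.le e V) (hY : Y ∈ regFibrePr F n K hnK.le e V)
    {sQ : ℝ} (hsQ0 : 0 ≤ sQ) (hsQL : 800000000000 * (F.L : ℝ) ^ 9 * sQ ≤ 1)
    (hsup : ∀ b : PBond (F.P K) 0, ‖((Y b * (W b)⁻¹ : Matrix.specialUnitaryGroup (Fin 2) ℂ) : Matrix (Fin 2) (Fin 2) ℂ) - 1‖ ≤ sQ * ((F.L : ℝ) ^ (K - n))⁻¹)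
    (D : PBond (F.P K) 0 → Matrix (Fin 2) (Fin 2) ℂ)
    (hD : D = fun b => (-Complex.I) • mlog ((Y b * (W b)⁻¹ : Matrix.specialUnitaryGroup (Fin 2) ℂ) : Matrix (Fin 2) (Fin 2) ℂ))
    (Q : (k : ℕ) → (PBond (F.P K) 0 → Matrix (Fin 2) (Fin 2) ℂ) → PBond (F.P K) k → Matrix (Fin 2) (Fin 2) ℂ) (hQ0 : ∀ Y, Q 0 Y = Y)
    (hQs : ∀ (k : ℕ) (Y : PBond (F.P K) 0 → Matrix (Fin 2) (Fin 2) ℂ) (c : PBond (F.P K) (k + 1)), Q (k + 1) Y c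
      = (fderiv ℂ (eml : (Idx (F.P K) → Matrix (Fin 2) (Fin 2) ℂ) → Matrix (Fin 2) (Fin 2) ℂ)
            (fun i => ((loopHol (Averaging.iter (fun i => blockAvg (P := (F.P K)) (j := i) (expMeanLogSU (n := Fin 2))) k W) c i : Matrix.specialUnitaryGroup (Fin 2) ℂ) : Matrix (Fin 2) (Fin 2) ℂ))
            (fun i => covWalkSum (Averaging.iter (fun i => blockAvg (P := (F.P K)) (j := i) (expMeanLogSU (n := Fin 2))) k W) (Q k Y) (walk (emb c.src) (loopWord (F.P K).L c.dir (off i.1) i.2.1 i.2.2))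
              * ((loopHol (Averaging.iter (fun i => blockAvg (P := (F.P K)) (j := i) (expMeanLogSU (n := Fin 2))) k W) c i : Matrix.specialUnitaryGroup (Fin 2) ℂ) : Matrix (Fin 2) (Fin 2) ℂ))
            * star ((corr (expMeanLogSU (n := Fin 2)) (Averaging.iter (fun i => blockAvg (P := (F.P K)) (j := i) (expMeanLogSU (n := Fin 2))) k W) c : Matrix.specialUnitaryGroup (Fin 2) ℂ) : Matrix (Fin 2) (Fin 2) ℂ)
          + ((corr (expMeanLogSU (n := Fin 2)) (Averaging.iter (fun i => blockAvg (P := (F.P K)) (j := i) (expMeanLogSU (n := Fin 2))) k W) c : Matrix.specialUnitaryGroup (Fin 2) ℂ) : Matrix (Fin 2) (Fin 2) ℂ)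
            * covWalkSum (Averaging.iter (fun i => blockAvg (P := (F.P K)) (j := i) (expMeanLogSU (n := Fin 2))) k W) (Q k Y) (walk (emb c.src) (List.replicate (F.P K).L (c.dir, true)))
            * star ((corr (expMeanLogSU (n := Fin 2)) (Averaging.iter (fun i => blockAvg (P := (F.P K)) (j := i) (expMeanLogSU (n := Fin 2))) k W) c : Matrix.specialUnitaryGroup (Fin 2) ℂ) : Matrix (Fin 2) (Fin 2) ℂ)))
    {θ ζ_X θ_X C_X η_X : ℝ}
    (B : PBond (F.P K) 0 → Matrix (Fin 2) (Fin 2) ℂ) (φ₀ : Site (F.P K) 0 → Matrix (Fin 2) (Fin 2) ℂ)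
    (hsplit : ∀ b : PBond (F.P K) 0, D b = B b + covD (torusT (F.P K) 0) (fun κ z => unitsField (toUField W) ⟨z, κ⟩) b.dir φ₀ b.src)
    (hBc : ∀ x : Site (F.P K) 0, divB (torusT (F.P K) 0) (fun κ z => unitsField (toUField W) ⟨z, κ⟩) (fun κ z => B ⟨z, κ⟩) x = 0)
    -- ▢ hXb′ — THE GAUSS COMPOSITE against the COMB-DIRECT face functional FACE′ (corner comb `treeWord (update r μ_c (ℓ−1))`, far-face crossing `t₀ = ℓ − 1 − r_{μ_c}`, centre frame)
    (hXb' : 2 * |∑ c : PBond (F.P K) (K - n), (((φ₀ (embIter (K - n) c.src)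
          - ((Averaging.iter (fun i => blockAvg (P := F.P K) (j := i) (expMeanLogSU (n := Fin 2))) (K - n) W c : Matrix.specialUnitaryGroup (Fin 2) ℂ) : Matrix (Fin 2) (Fin 2) ℂ)
              * φ₀ (embIter (K - n) c.tgt)
              * star ((Averaging.iter (fun i => blockAvg (P := F.P K) (j := i) (expMeanLogSU (n := Fin 2))) (K - n) W c : Matrix.specialUnitaryGroup (Fin 2) ℂ) : Matrix (Fin 2) (Fin 2) ℂ))ᴴ
          * ((((((F.P K).L : ℝ) ^ (K - n)) ^ (F.P K).d)⁻¹ •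
              (((holAt W (walk (embIter (K - n) c.src) (treeWord fun _ : Fin (F.P K).d => -((((F.P K).L ^ (K - n) - 1) / 2 : ℕ) : ℤ))) : Matrix.specialUnitaryGroup (Fin 2) ℂ) :
                  Matrix (Fin 2) (Fin 2) ℂ)
                * ((((F.P K).L : ℝ) ^ (K - n)) • ∑ r : Fin (F.P K).d → Fin ((F.P K).L ^ (K - n)),
                    conjR (holT (unitsField (toUField W)) (Site.fibreSite 0 (K - n) c.src fun _ => ⟨0, pow_pos (F.P K).L_pos (K - n)⟩)
                        (treeWord fun ν => ((Function.update r c.dir ⟨(F.P K).L ^ (K - n) - 1, Nat.sub_lt (pow_pos (F.P K).L_pos (K - n)) Nat.one_pos⟩ ν : ℕ) : ℤ)))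
                      (B ⟨(fun z : Site (F.P K) 0 => z.shift c.dir)^[(F.P K).L ^ (K - n) - 1 - (r c.dir : ℕ)] (Site.fibreSite 0 (K - n) c.src r), c.dir⟩))
                * star (((holAt W (walk (embIter (K - n) c.src) (treeWord fun _ : Fin (F.P K).d => -((((F.P K).L ^ (K - n) - 1) / 2 : ℕ) : ℤ))) : Matrix.specialUnitaryGroup (Fin 2) ℂ) :
                  Matrix (Fin 2) (Fin 2) ℂ)))))).trace).re|
      ≤ ((F.L : ℝ) ^ (K - n)) * (ζ_X / θ) * (∑ p : Plaq (F.P K) 0, ‖((Complex.I • D ⟨p.src, p.μ⟩) + ((W ⟨p.src, p.μ⟩ : Matrix (Fin 2) (Fin 2) ℂ) * (Complex.I • D ⟨p.src.shift p.μ, p.ν⟩) * star (W ⟨p.src, p.μ⟩ : Matrix (Fin 2) (Fin 2) ℂ))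
            - (((W ⟨p.src, p.μ⟩ * W ⟨p.src.shift p.μ, p.ν⟩ * (W ⟨p.src.shift p.ν, p.μ⟩)⁻¹ : Matrix.specialUnitaryGroup (Fin 2) ℂ) : Matrix (Fin 2) (Fin 2) ℂ) * (Complex.I • D ⟨p.src.shift p.ν, p.μ⟩) * star ((W ⟨p.src, p.μ⟩ * W ⟨p.src.shift p.μ, p.ν⟩ * (W ⟨p.src.shift p.ν, p.μ⟩)⁻¹ : Matrix.specialUnitaryGroup (Fin 2) ℂ) : Matrix (Fin 2) (Fin 2) ℂ))
            - (((GaugeField.plaqHol W p : Matrix.specialUnitaryGroup (Fin 2) ℂ) : Matrix (Fin 2) (Fin 2) ℂ) * (Complex.I • D ⟨p.src, p.ν⟩) * star ((GaugeField.plaqHol W p : Matrix.specialUnitaryGroup (Fin 2) ℂ) : Matrix (Fin 2) (Fin 2) ℂ)))‖ ^ 2)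
        + θ * ((F.L : ℝ) ^ (K - n))⁻¹ * (∑ b : PBond (F.P K) 0, ‖D b‖ ^ 2)
        + θ_X * e * ((F.L : ℝ) ^ (K - n))⁻¹ * (∑ b : PBond (F.P K) 0, ‖D b‖ ^ 2)
        + C_X * ((F.L : ℝ) ^ (K - n)) * (∑ b : PBond (F.P K) 0, ∑ ν : Fin (F.P K).d,
                ‖((W ⟨b.src, ν⟩ : Matrix.specialUnitaryGroup (Fin 2) ℂ) : Matrix (Fin 2) (Fin 2) ℂ) * B ⟨b.src.shift ν, b.dir⟩ * star ((W ⟨b.src, ν⟩ : Matrix.specialUnitaryGroup (Fin 2) ℂ) : Matrix (Fin 2) (Fin 2) ℂ) - B b‖ ^ 2)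
        + η_X * ((F.L : ℝ) ^ (K - n)) * (∑ x : Site (F.P K) 0, ∑ j : Fin 2, ∑ k : Fin 2,
              ‖(divB (torusT (F.P K) 0) (fun κ z => unitsField (toUField W) ⟨z, κ⟩) (fun κ z => Complex.I • D ⟨z, κ⟩) x) j k‖ ^ 2)) :
    (∑ c : PBond (F.P K) (K - n), ∑ a : Fin 2, ∑ b : Fin 2,
        Complex.normSq ((φ₀ (embIter (K - n) c.src) - ((Averaging.iter (fun i => blockAvg (P := F.P K) (j := i) (expMeanLogSU (n := Fin 2))) (K - n) W c : Matrix.specialUnitaryGroup (Fin 2) ℂ) : Matrix (Fin 2) (Fin 2) ℂ)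
            * φ₀ (embIter (K - n) c.tgt) * star ((Averaging.iter (fun i => blockAvg (P := F.P K) (j := i) (expMeanLogSU (n := Fin 2))) (K - n) W c : Matrix.specialUnitaryGroup (Fin 2) ℂ) : Matrix (Fin 2) (Fin 2) ℂ)) a b))
      ≤ ((F.L : ℝ) ^ (K - n)) * (ζ_X / θ + 8 * (24000000000000000000000 * (F.L : ℝ) ^ 20 * sQ ^ 2)) * (∑ p : Plaq (F.P K) 0, ‖((Complex.I • D ⟨p.src, p.μ⟩) + ((W ⟨p.src, p.μ⟩ : Matrix (Fin 2) (Fin 2) ℂ) * (Complex.I • D ⟨p.src.shift p.μ, p.ν⟩) * star (W ⟨p.src, p.μ⟩ : Matrix (Fin 2) (Fin 2) ℂ))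
            - (((W ⟨p.src, p.μ⟩ * W ⟨p.src.shift p.μ, p.ν⟩ * (W ⟨p.src.shift p.ν, p.μ⟩)⁻¹ : Matrix.specialUnitaryGroup (Fin 2) ℂ) : Matrix (Fin 2) (Fin 2) ℂ) * (Complex.I • D ⟨p.src.shift p.ν, p.μ⟩) * star ((W ⟨p.src, p.μ⟩ * W ⟨p.src.shift p.μ, p.ν⟩ * (W ⟨p.src.shift p.ν, p.μ⟩)⁻¹ : Matrix.specialUnitaryGroup (Fin 2) ℂ) : Matrix (Fin 2) (Fin 2) ℂ))
            - (((GaugeField.plaqHol W p : Matrix.specialUnitaryGroup (Fin 2) ℂ) : Matrix (Fin 2) (Fin 2) ℂ) * (Complex.I • D ⟨p.src, p.ν⟩) * star ((GaugeField.plaqHol W p : Matrix.specialUnitaryGroup (Fin 2) ℂ) : Matrix (Fin 2) (Fin 2) ℂ)))‖ ^ 2)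
        + (θ + 8 * (15000000000000000000 * (F.L : ℝ) ^ 18 * sQ ^ 2)) * ((F.L : ℝ) ^ (K - n))⁻¹ * (∑ b : PBond (F.P K) 0, ‖D b‖ ^ 2)
        + (θ_X + 64 * ((4770 * (F.L : ℝ) ^ 3) ^ 2 * ((5 * (F.L : ℝ)) ^ 2 / 2) ^ 2 / 4
              + (2 * (5 * (F.L : ℝ)) ^ 3 / ((F.L : ℝ) * ((F.L : ℝ) - 1) * ((F.L : ℝ) ^ 2 - 1)) + (2 * (5 * (F.L : ℝ)) + 2 * 3 + 1) ^ 2 / 2) ^ 2)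
              + 768000000000 * (F.L : ℝ) ^ 9 + 16) * e * ((F.L : ℝ) ^ (K - n))⁻¹ * (∑ b : PBond (F.P K) 0, ‖D b‖ ^ 2)
        + (C_X + 24) * ((F.L : ℝ) ^ (K - n)) * (∑ b : PBond (F.P K) 0, ∑ ν : Fin (F.P K).d,
                ‖((W ⟨b.src, ν⟩ : Matrix.specialUnitaryGroup (Fin 2) ℂ) : Matrix (Fin 2) (Fin 2) ℂ) * B ⟨b.src.shift ν, b.dir⟩ * star ((W ⟨b.src, ν⟩ : Matrix.specialUnitaryGroup (Fin 2) ℂ) : Matrix (Fin 2) (Fin 2) ℂ) - B b‖ ^ 2)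
        + 19200 * (F.L : ℝ) ^ 4 * ((F.L : ℝ) ^ (K - n)) * (∑ x : Site (F.P K) 0, ∑ μ : Fin (F.P K).d, ∑ ν : Fin (F.P K).d,
                (if μ < ν then ∑ j : Fin 2, ∑ k : Fin 2, ‖(curl (torusT (F.P K) 0) (fun κ z => unitsField (toUField W) ⟨z, κ⟩) (fun κ z => B ⟨z, κ⟩) μ ν x) j k‖ ^ 2 else 0))
        + (η_X + 8 * (24000000000000000000000 * (F.L : ℝ) ^ 20 * sQ ^ 2)) * ((F.L : ℝ) ^ (K - n)) * (∑ x : Site (F.P K) 0, ∑ j : Fin 2, ∑ k : Fin 2,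
              ‖(divB (torusT (F.P K) 0) (fun κ z => unitsField (toUField W) ⟨z, κ⟩) (fun κ z => Complex.I • D ⟨z, κ⟩) x) j k‖ ^ 2) := by
  -- windows
  have hL3 := three_le_L F
  have hL1 : (1 : ℝ) ≤ (F.L : ℝ) := by linarith only [hL3]
  have heL' : 1000000 * (F.L : ℝ) ^ 5 * e ≤ 1 := by
    have h59 : (F.L : ℝ) ^ 5 ≤ (F.L : ℝ) ^ 9 := pow_le_pow_right₀ hL1 (by norm_num)
    nlinarith [h59, he.le]
  -- the background plaquette row from membership
  have hU := dist1_plaqHol_le_of_mem_regFibrePr F hnK.le hW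
  -- the defect row at the member, ×8
  have hq0 := linAvgDefect_of_exactFibrePoint F hnK he heL hW hY hsQ0 hsQL hsup D hD Q hQ0 hQs
  have hq3 : 8 * ∑ c : PBond (F.P K) (K - n), ‖Q (K - n) D c‖ ^ 2
      ≤ (8 * (15000000000000000000 * (F.L : ℝ) ^ 18 * sQ ^ 2)) * ((F.L : ℝ) ^ (K - n))⁻¹ * (∑ b : PBond (F.P K) 0, ‖D b‖ ^ 2)
        + (8 * (24000000000000000000000 * (F.L : ℝ) ^ 20 * sQ ^ 2)) * ((F.L : ℝ) ^ (K - n)) * (∑ p : Plaq (F.P K) 0, ‖((Complex.I • D ⟨p.src, p.μ⟩) + ((W ⟨p.src, p.μ⟩ : Matrix (Fin 2) (Fin 2) ℂ) * (Complex.I • D ⟨p.src.shift p.μ, p.ν⟩) * star (W ⟨p.src, p.μ⟩ : Matrix (Fin 2) (Fin 2) ℂ))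
              - (((W ⟨p.src, p.μ⟩ * W ⟨p.src.shift p.μ, p.ν⟩ * (W ⟨p.src.shift p.ν, p.μ⟩)⁻¹ : Matrix.specialUnitaryGroup (Fin 2) ℂ) : Matrix (Fin 2) (Fin 2) ℂ) * (Complex.I • D ⟨p.src.shift p.ν, p.μ⟩) * star ((W ⟨p.src, p.μ⟩ * W ⟨p.src.shift p.μ, p.ν⟩ * (W ⟨p.src.shift p.ν, p.μ⟩)⁻¹ : Matrix.specialUnitaryGroup (Fin 2) ℂ) : Matrix (Fin 2) (Fin 2) ℂ))
              - (((GaugeField.plaqHol W p : Matrix.specialUnitaryGroup (Fin 2) ℂ) : Matrix (Fin 2) (Fin 2) ℂ) * (Complex.I • D ⟨p.src, p.ν⟩) * star ((GaugeField.plaqHol W p : Matrix.specialUnitaryGroup (Fin 2) ℂ) : Matrix (Fin 2) (Fin 2) ℂ)))‖ ^ 2)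
        + (8 * (24000000000000000000000 * (F.L : ℝ) ^ 20 * sQ ^ 2)) * ((F.L : ℝ) ^ (K - n)) * (∑ x : Site (F.P K) 0, ∑ j : Fin 2, ∑ k : Fin 2,
                ‖(divB (torusT (F.P K) 0) (fun κ z => unitsField (toUField W) ⟨z, κ⟩) (fun κ z => Complex.I • D ⟨z, κ⟩) x) j k‖ ^ 2) := by
    linarith only [hq0]
  exact rowP_of_combFaceFluxRows_hq3 F n K W he heL' hU D B φ₀ hsplit hBc Q hQ0 hQs hq3 hXb'

end Summit.QuantumFields.YangMills.Theorems.Prop7RowPOfCombFaceFluxRowsHq3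

end
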